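import Literature.Topology.FourManifolds.LinkLeeStates
import Literature.Topology.FourManifolds.LinkKhBirthDeath
import Literature.Topology.FourManifolds.LinkKhDichotomy
import HarnessLib

/-!
# Rasmussen's Prop. 4.1 for births and deaths: canonical generators go to canonical generators

Link tower, layer T5a. Inputs: Lee's canonical states and monomials of `LinkLeeStates` (D2c:
`IsCheckerboard c`, `leeState hc t u`, `leeMonomial k s = (s₁ ↦ [σ₁ = σ] (-1)^{pairCount σ λ₁ ℓ})`,
`leeMonomial_leeState_mem_leeCycles`), the unit / counit chain maps of `LinkKhBirthDeath` (T4a: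
`birthMap R i f s' = [s'.label newArc = false] f (s'|)`, `deathMap R i g s = g (s ⊗ X)`,
`EnhancedState.extend / restrict`, `leeHomologyZeroBirth / Death`) and the persistence of
checkerboard colourings `isCheckerboard_birth_iff` of `LinkKhDichotomy` (T1b).

## Statement (Rasmussen (2010), Prop. 4.1, births and deaths)

Each elementary Morse cobordism map sends Lee's canonical generator `𝔰_o` to a NONZERO multiple
of the canonical generator(s) of the compatible orientation(s). For a birth both orientations of
the newborn circle are compatible; for a death exactly the restricted orientation is.

## Normalisation and the computed constants

Labels are read in Lee's basis as in `LinkLeeStates`: `false ↔ 𝐚 = X + 1`, `true ↔ 𝐛 = X - 1`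
(the Lee monomial of `(σ, ℓ)` has coefficient `(-1)^{#circles labelled (λ = 1, ℓ = 𝐛)}` on
`(σ, λ)`), and `LinkKhBirthDeath` labels the new free circle `newArc = inr (Fin.last free)` by
`false ↔ 1`, `true ↔ X`; the free-circle labels of the canonical state of `L.birth` are the
extension `Fin.snoc u b` of those of `L` (`leeState_extend`). Unfolding the definitions
(`pairCount_birth`: the new circle contributes `[λ(newArc) = 1 ∧ b = 𝐛]` to `pairCount`;
`leeMonomial_extend`):

* **Birth** (unit `ι(x) = x ⊗ 1`, and `1 = (𝐚 - 𝐛) / 2`):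
  `ι(𝔰) = α • (𝔰 ⊗ 𝐛) + β • (𝔰 ⊗ 𝐚)` with **`α = -1/2`** (new circle labelled `true = 𝐛`) and
  **`β = 1/2`** (new circle labelled `false = 𝐚`): `birthMap_leeMonomial`,
  `birthMap_leeMonomial_leeState`; both nonzero (`birth_coeff_ne_zero`).
* **Death** (counit `ε(1) = 0`, `ε(X) = 1`, so `ε(𝐚) = ε(X + 1) = 1`, `ε(𝐛) = ε(X - 1) = 1`):
  `ε(𝔰 ⊗ 𝐚) = ε(𝔰 ⊗ 𝐛) = 𝔰`, i.e. **`γ(false) = γ(true) = 1`**: `deathMap_leeMonomial_extend`,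
  `deathMap_leeMonomial_leeState_snoc`, `deathMap_leeMonomial_leeState` (`Fin.init`).

Both computations hold for the Lee monomial of an ARBITRARY enhanced state `s` in any
homological degree `k` (they only see the tensor factor of the new circle), and are then
specialised to the canonical states. Corollaries: the images are nonzero
(`birthMap_leeMonomial_leeState_ne_zero`, `deathMap_leeMonomial_leeState_ne_zero`), the induced
maps on `Kh'⁰` (`leeHomologyZeroBirth_mk_leeState`, `leeHomologyZeroDeath_mk_leeState`), and the
unlinks `unknots k` (where every enhanced state is canonical, `leeState_unknots_bijective`).

Not here: the saddle (`LinkLeeSaddleCanonical`, on top of `LinkKhSaddleChain`), Reidemeister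
moves, and the assembly of Rasmussen's Thm. 1 for links.

## References

* J. Rasmussen, *Khovanov homology and the slice genus*, Invent. Math. 182 (2010) 419–447, §4,
  Prop. 4.1, eq. (4.1). [cite: Rasmussen2010, Prop. 4.1]
* E. S. Lee, *An endomorphism of the Khovanov invariant*, Adv. Math. 197 (2005) 554–586, §4
  (the basis `𝐚`, `𝐛`; `ι`, `ε` in this basis). [cite: Lee2005, §4]
* M. Khovanov, *A categorification of the Jones polynomial*, Duke Math. J. 101 (2000), §6.2
  (cup and cap). [cite: Khovanov2000, §6]
-/

open Function Set

noncomputable section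

namespace Literature.Topology.FourManifolds

namespace LinkGaussDiagram

variable {L : LinkGaussDiagram}

/-! ## The new free circle in `pairCount` and in the Lee monomials -/

/-- **`pairCount` across a birth.** For labellings `λ`, `ℓ` of the arcs of `L.birth`, the number
of state circles labelled `(λ = 1, ℓ = 𝐛)` is that of the restrictions to `L` plus the
contribution `[λ(newArc) = 1 ∧ ℓ(newArc) = 𝐛]` of the new free circle (state circles of
`L.birth` = those of `L` ⊔ the new circle, `stateCircleBirthEquiv`). [cite: Lee2005, §4] -/
theorem pairCount_birth (σ : L.State) (lam ell : L.birth.Arc → Bool) :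
    L.birth.pairCount σ lam ell = L.pairCount σ (lam ∘ L.embedArc) (ell ∘ L.embedArc) +
      if (!lam L.newArc && ell L.newArc) = true then 1 else 0 := by
  have hiff₁ : ∀ C : L.StateCircle σ,
      (∃ a, L.birth.circleOf σ a = L.stateCircleBirthEquiv σ (.inl C) ∧
          (!lam a && ell a) = true) ↔
        ∃ a, L.circleOf σ a = C ∧ (!(lam ∘ L.embedArc) a && (ell ∘ L.embedArc) a) = true := by
    intro C
    constructor
    · rintro ⟨a', ha', hv⟩
      rcases L.birth_arc_cases a' with ⟨a, rfl⟩ | rfl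
      · exact ⟨a, Sum.inl_injective ((L.stateCircleBirthEquiv σ).injective
          ((L.stateCircleBirthEquiv_inl σ a).trans ha')), hv⟩
      · exact absurd ((L.stateCircleBirthEquiv σ).injective
          ((L.stateCircleBirthEquiv_inr σ ()).trans ha')) Sum.inr_ne_inl
    · rintro ⟨a, rfl, hv⟩
      exact ⟨L.embedArc a, (L.stateCircleBirthEquiv_inl σ a).symm, hv⟩
  have hiff₂ : (∃ a, L.birth.circleOf σ a = L.birth.circleOf σ L.newArc ∧
      (!lam a && ell a) = true) ↔ (!lam L.newArc && ell L.newArc) = true := by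
    constructor
    · rintro ⟨a', ha', hv⟩
      obtain rfl : a' = L.newArc := (L.circleOf_birth_newArc_eq_iff σ a').1 ha'.symm
      exact hv
    · exact fun hv ↦ ⟨L.newArc, rfl, hv⟩
  unfold pairCount
  rw [Finset.card_filter, Finset.card_filter, ← (L.stateCircleBirthEquiv σ).sum_comp,
    Fintype.sum_sum_type]
  simp only [Finset.univ_unique, Finset.sum_singleton, stateCircleBirthEquiv_inr]
  congr 1
  · exact Finset.sum_congr rfl fun C _ ↦ if_congr (hiff₁ C) rfl rfl
  · exact if_congr hiff₂ rfl rfl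

/-- **`pairCount` of an extension** (the form of `pairCount_birth` whose two sides are
well typed syntactically, `(s.extend b).state : L.birth.State` and `s.state : L.State`): the
new circle contributes `[λ(newArc) = 1 ∧ b = 𝐛]`. [cite: Lee2005, §4] -/
theorem pairCount_extend (s : L.EnhancedState) (b : Bool) (lam : L.birth.Arc → Bool) :
    L.birth.pairCount (s.extend b).state lam (s.extend b).label =
      L.pairCount s.state (lam ∘ L.embedArc) s.label +
        if (!lam L.newArc && b) = true then 1 else 0 := by
  have h1 : (s.extend b).label ∘ L.embedArc = s.label :=
    funext fun a ↦ s.extend_label_embedArc b a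
  have h := pairCount_birth s.state lam (s.extend b).label
  rw [h1, EnhancedState.extend_label_newArc] at h
  exact h

/-- **The Lee monomial of an extended enhanced state** `s ⊗ b` of `L.birth`, evaluated at a
state `s'` of `L.birth`: the Lee monomial of `s` at the restriction `s'|`, times the sign `-1`
exactly when the new circle carries `λ = 1` in `s'` and `ℓ = 𝐛` (`b = true`) in `s ⊗ b` — the
tensor factor `𝐚 = 1 + X` or `𝐛 = -1 + X` of the new circle. Lee (2005), §4.
[cite: Lee2005, §4] -/
theorem leeMonomial_extend (k : ℤ) (s : L.EnhancedState) (b : Bool) (s' : L.birth.degStates k) :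
    L.birth.leeMonomial k (s.extend b) s' =
      (if (!s'.1.label L.newArc && b) = true then -1 else 1) *
        L.leeMonomial k s (L.restrictD k s') := by
  by_cases hσ : (L.restrictD k s').1.state = s.state
  · have e1 : L.birth.leeMonomial k (s.extend b) s' =
        (-1 : ℚ) ^ L.birth.pairCount (s.extend b).state s'.1.label (s.extend b).label :=
      if_pos (show s'.1.state = (s.extend b).state from hσ)
    have e2 : L.leeMonomial k s (L.restrictD k s') =
        (-1 : ℚ) ^ L.pairCount s.state (s'.1.label ∘ L.embedArc) s.label :=
      if_pos hσ
    rw [e1, e2, pairCount_extend, pow_add]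
    split_ifs <;> ring
  · have e1 : L.birth.leeMonomial k (s.extend b) s' = 0 :=
      if_neg (show ¬ s'.1.state = (s.extend b).state from hσ)
    have e2 : L.leeMonomial k s (L.restrictD k s') = 0 := if_neg hσ
    rw [e1, e2, mul_zero]

/-! ## Birth: the unit on Lee monomials (`1 = (𝐚 - 𝐛) / 2`) -/

/-- **The unit on a Lee monomial** (any enhanced state `s`, any homological degree):
`ι(⊗_C ℓ(C)) = (⊗_C ℓ(C)) ⊗ 1 = -½ · (s ⊗ 𝐛) + ½ · (s ⊗ 𝐚)` since `1 = (𝐚 - 𝐛) / 2` in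
`ℚ[X]/(X² - 1)`: the constants of Prop. 4.1 for a birth are `α = -1/2` (new circle `𝐛 = true`)
and `β = 1/2` (new circle `𝐚 = false`). Rasmussen (2010), Prop. 4.1; Lee (2005), §4.
[cite: Rasmussen2010, Prop. 4.1] -/
theorem birthMap_leeMonomial (k : ℤ) (s : L.EnhancedState) :
    L.birthMap ℚ k (L.leeMonomial k s) =
      (-(1 / 2) : ℚ) • L.birth.leeMonomial k (s.extend true) +
        (1 / 2 : ℚ) • L.birth.leeMonomial k (s.extend false) := by
  funext s'
  rw [Pi.add_apply, Pi.smul_apply, Pi.smul_apply, smul_eq_mul, smul_eq_mul, birthMap_apply,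
    leeMonomial_extend, leeMonomial_extend, Bool.and_true, Bool.and_false,
    if_neg Bool.false_ne_true, one_mul]
  cases hb : s'.1.label L.newArc
  · rw [if_pos rfl, Bool.not_false, if_pos rfl]
    ring
  · rw [if_neg (fun h ↦ Bool.false_ne_true h.symm), Bool.not_true, if_neg Bool.false_ne_true]
    ring

/-- **Both birth constants are nonzero**: `α = -1/2 ≠ 0` and `β = 1/2 ≠ 0` (Prop. 4.1 for a
birth: both orientations of the newborn circle are compatible and both canonical generators
occur). [cite: Rasmussen2010, Prop. 4.1] -/
theorem birth_coeff_ne_zero : (-(1 / 2) : ℚ) ≠ 0 ∧ (1 / 2 : ℚ) ≠ 0 := by norm_num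

/-! ## Death: the counit on Lee monomials (`ε(𝐚) = ε(𝐛) = 1`) -/

/-- **The counit on a Lee monomial** (any enhanced state `s` of `L`, any label `b` of the dying
circle, any homological degree): `ε(s ⊗ 𝐚) = ε(s ⊗ 𝐛) = s`, since `ε(X) = 1`, `ε(1) = 0` give
`ε(X ± 1) = 1`: the constant of Prop. 4.1 for a death is `γ = 1` for both labels.
Rasmussen (2010), Prop. 4.1; Lee (2005), §4. [cite: Rasmussen2010, Prop. 4.1] -/
theorem deathMap_leeMonomial_extend (k : ℤ) (s : L.EnhancedState) (b : Bool) :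
    L.deathMap ℚ k (L.birth.leeMonomial k (s.extend b)) = L.leeMonomial k s := by
  funext u
  rw [deathMap_apply, leeMonomial_extend, extendD_val, EnhancedState.extend_label_newArc,
    Bool.not_true, Bool.false_and, if_neg Bool.false_ne_true, one_mul, restrictD_extendD]

/-! ## Lee's canonical states under a birth -/

/-- A checkerboard colouring of `L` is one of `L.birth` (same chords, same traversal;
`isCheckerboard_birth_iff`). [cite: Rasmussen2010, §4.1] -/
theorem IsCheckerboard.birth {c : Fin (2 * L.n) → Bool} (hc : L.IsCheckerboard c) :
    L.birth.IsCheckerboard c :=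
  (L.isCheckerboard_birth_iff c).2 hc

/-- **The canonical states of `L.birth` are the extensions of those of `L`**: extending
`leeState hc t u` by the label `b` on the new free circle gives the canonical state of `L.birth`
with free-circle labels `Fin.snoc u b` (the new circle is `inr (Fin.last free)`). Both
orientations `b = 𝐚, 𝐛` of the newborn circle give canonical states. Rasmussen (2010), §2.3,
§4.1. [cite: Rasmussen2010, Prop. 4.1] -/
theorem leeState_extend {c : Fin (2 * L.n) → Bool} (hc : L.IsCheckerboard c)
    (hc' : L.birth.IsCheckerboard c) (t : Bool) (u : Fin L.free → Bool) (b : Bool) :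
    (L.leeState hc t u).extend b = L.birth.leeState hc' t (Fin.snoc u b) := by
  refine EnhancedState.ext' rfl (funext fun a ↦ ?_)
  rcases L.birth_arc_cases a with ⟨a, rfl⟩ | rfl
  · rw [EnhancedState.extend_label_embedArc, leeState_label, leeState_label]
    rcases a with r | j
    · rfl
    · rw [embedArc_inr, leeLabel_inr, leeLabel_inr, Fin.snoc_castSucc]
  · rw [EnhancedState.extend_label_newArc, leeState_label]
    show b = L.birth.leeLabel c t (Fin.snoc u b) (.inr (Fin.last L.free))
    rw [leeLabel_inr, Fin.snoc_last]

/-- Conversely, the canonical state of `L.birth` with free-circle labels `u'` is the extension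
of the canonical state of `L` with labels `Fin.init u'` by the label `u' (Fin.last _)` of the
new circle. [cite: Rasmussen2010, Prop. 4.1] -/
theorem leeState_birth_eq_extend {c : Fin (2 * L.n) → Bool} (hc : L.IsCheckerboard c)
    (hc' : L.birth.IsCheckerboard c) (t : Bool) (u' : Fin (L.free + 1) → Bool) :
    L.birth.leeState hc' t u' =
      (L.leeState hc t (Fin.init u')).extend (u' (Fin.last L.free)) := by
  rw [leeState_extend hc hc']
  congr 1
  exact (Fin.snoc_init_self u').symm

/-! ## Prop. 4.1 for a birth -/

/-- **Rasmussen's Prop. 4.1 for a birth.** The unit `ι : C(L) → C(L ⊔ ◯)` sends the canonical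
generator `𝔰_o = leeMonomial 0 (leeState hc t u)` to
`-½ • 𝔰_{o, ◯ ↦ 𝐛} + ½ • 𝔰_{o, ◯ ↦ 𝐚}`, the canonical generators of `L.birth` for the two
orientations of the newborn circle (free-circle labels `Fin.snoc u true`, `Fin.snoc u false`),
with the nonzero constants `α = -1/2`, `β = 1/2` (`birth_coeff_ne_zero`). Rasmussen (2010),
Prop. 4.1. [cite: Rasmussen2010, Prop. 4.1] -/
theorem birthMap_leeMonomial_leeState {c : Fin (2 * L.n) → Bool} (hc : L.IsCheckerboard c)
    (t : Bool) (u : Fin L.free → Bool) :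
    L.birthMap ℚ 0 (L.leeMonomial 0 (L.leeState hc t u)) =
      (-(1 / 2) : ℚ) • L.birth.leeMonomial 0 (L.birth.leeState hc.birth t (Fin.snoc u true)) +
        (1 / 2 : ℚ) • L.birth.leeMonomial 0 (L.birth.leeState hc.birth t (Fin.snoc u false)) := by
  rw [birthMap_leeMonomial, leeState_extend hc hc.birth, leeState_extend hc hc.birth]

/-- **The image of a canonical generator under the unit is nonzero** (its coefficient on the
state `𝔰 ⊗ 1` is `1`). [cite: Rasmussen2010, Prop. 4.1] -/
theorem birthMap_leeMonomial_leeState_ne_zero {c : Fin (2 * L.n) → Bool}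
    (hc : L.IsCheckerboard c) (t : Bool) (u : Fin L.free → Bool) :
    L.birthMap ℚ 0 (L.leeMonomial 0 (L.leeState hc t u)) ≠ 0 := by
  intro h
  have h1 := congrFun h (L.extendD 0 ⟨L.leeState hc t u, homDegree_leeState hc t u⟩ false)
  rw [birthMap_apply, extendD_val, EnhancedState.extend_label_newArc, if_pos rfl,
    restrictD_extendD, leeMonomial_self ⟨L.leeState hc t u, homDegree_leeState hc t u⟩,
    Pi.zero_apply] at h1
  exact one_ne_zero h1

/-! ## Prop. 4.1 for a death -/

/-- **Rasmussen's Prop. 4.1 for a death.** The counit `ε : C(L ⊔ ◯) → C(L)` sends the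
canonical generator of `L.birth` with free-circle labels `Fin.snoc u b` to `γ(b) • 𝔰_o` with
`γ(false) = γ(true) = 1`: whatever the orientation `b` of the dying circle, the image is exactly
the canonical generator `leeMonomial 0 (leeState hc t u)` of `L` (nonzero multiple, constant
`1`). Rasmussen (2010), Prop. 4.1. [cite: Rasmussen2010, Prop. 4.1] -/
theorem deathMap_leeMonomial_leeState_snoc {c : Fin (2 * L.n) → Bool}
    (hc : L.IsCheckerboard c) (t : Bool) (u : Fin L.free → Bool) (b : Bool) :
    L.deathMap ℚ 0 (L.birth.leeMonomial 0 (L.birth.leeState hc.birth t (Fin.snoc u b))) =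
      L.leeMonomial 0 (L.leeState hc t u) := by
  rw [← leeState_extend hc hc.birth, deathMap_leeMonomial_extend]

/-- **Prop. 4.1 for a death, free-circle labels `u'` of `L.birth`**: the counit sends the
canonical generator with labels `u'` to the canonical generator of `L` with labels `Fin.init u'`
(coefficient `γ (u' (Fin.last _)) = 1`). [cite: Rasmussen2010, Prop. 4.1] -/
theorem deathMap_leeMonomial_leeState {c : Fin (2 * L.n) → Bool} (hc : L.IsCheckerboard c)
    (t : Bool) (u' : Fin (L.free + 1) → Bool) :
    L.deathMap ℚ 0 (L.birth.leeMonomial 0 (L.birth.leeState hc.birth t u')) =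
      L.leeMonomial 0 (L.leeState hc t (Fin.init u')) := by
  rw [leeState_birth_eq_extend hc hc.birth, deathMap_leeMonomial_extend]

/-- The image of a canonical generator of `L.birth` under the counit is nonzero.
[cite: Rasmussen2010, Prop. 4.1] -/
theorem deathMap_leeMonomial_leeState_ne_zero {c : Fin (2 * L.n) → Bool}
    (hc : L.IsCheckerboard c) (t : Bool) (u' : Fin (L.free + 1) → Bool) :
    L.deathMap ℚ 0 (L.birth.leeMonomial 0 (L.birth.leeState hc.birth t u')) ≠ 0 := by
  rw [deathMap_leeMonomial_leeState hc]
  exact leeMonomial_leeState_ne_zero hc t _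

/-! ## On Lee homology in degree zero -/

/-- **Prop. 4.1 for a birth on `Kh'⁰`**: the induced map `leeHomologyZeroBirth` sends the class
`[𝔰_o]` to `-½ • [𝔰_{o, ◯ ↦ 𝐛}] + ½ • [𝔰_{o, ◯ ↦ 𝐚}]`. [cite: Rasmussen2010, Prop. 4.1] -/
theorem leeHomologyZeroBirth_mk_leeState {c : Fin (2 * L.n) → Bool} (hc : L.IsCheckerboard c)
    (t : Bool) (u : Fin L.free → Bool) :
    L.leeHomologyZeroBirth (Submodule.Quotient.mk
        ⟨L.leeMonomial 0 (L.leeState hc t u), leeMonomial_leeState_mem_leeCycles hc t u⟩) =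
      (-(1 / 2) : ℚ) • Submodule.Quotient.mk
          ⟨L.birth.leeMonomial 0 (L.birth.leeState hc.birth t (Fin.snoc u true)),
            leeMonomial_leeState_mem_leeCycles hc.birth t _⟩ +
        (1 / 2 : ℚ) • Submodule.Quotient.mk
          ⟨L.birth.leeMonomial 0 (L.birth.leeState hc.birth t (Fin.snoc u false)),
            leeMonomial_leeState_mem_leeCycles hc.birth t _⟩ := by
  have key : (⟨L.birthMap ℚ 0 (L.leeMonomial 0 (L.leeState hc t u)),
      L.birthMap_mem_leeCycles (leeMonomial_leeState_mem_leeCycles hc t u)⟩ :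
        L.birth.leeCycles) =
      (-(1 / 2) : ℚ) • ⟨L.birth.leeMonomial 0 (L.birth.leeState hc.birth t (Fin.snoc u true)),
          leeMonomial_leeState_mem_leeCycles hc.birth t _⟩ +
        (1 / 2 : ℚ) • ⟨L.birth.leeMonomial 0 (L.birth.leeState hc.birth t (Fin.snoc u false)),
          leeMonomial_leeState_mem_leeCycles hc.birth t _⟩ :=
    Subtype.ext (birthMap_leeMonomial_leeState hc t u)
  rw [leeHomologyZeroBirth_mk]
  exact congrArg Submodule.Quotient.mk key

/-- **Prop. 4.1 for a death on `Kh'⁰`**: `leeHomologyZeroDeath` sends the class of the canonical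
generator with free-circle labels `u'` to the class of the canonical generator of `L` with labels
`Fin.init u'` (coefficient `1`). [cite: Rasmussen2010, Prop. 4.1] -/
theorem leeHomologyZeroDeath_mk_leeState {c : Fin (2 * L.n) → Bool} (hc : L.IsCheckerboard c)
    (t : Bool) (u' : Fin (L.free + 1) → Bool) :
    L.leeHomologyZeroDeath (Submodule.Quotient.mk
        ⟨L.birth.leeMonomial 0 (L.birth.leeState hc.birth t u'),
          leeMonomial_leeState_mem_leeCycles hc.birth t u'⟩) =
      Submodule.Quotient.mk ⟨L.leeMonomial 0 (L.leeState hc t (Fin.init u')),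
        leeMonomial_leeState_mem_leeCycles hc t _⟩ := by
  rw [leeHomologyZeroDeath_mk]
  congr 1
  exact Subtype.ext (deathMap_leeMonomial_leeState hc t u')

/-- The class of the image of a canonical generator under the death map is the class of a
canonical generator, in particular the death map does not kill `[𝔰]` as a CYCLE (its image is
a nonzero cycle; whether the class is nonzero is Lee's theorem, not used here).
[cite: Rasmussen2010, Prop. 4.1] -/
theorem deathMap_leeMonomial_leeState_mem_leeCycles {c : Fin (2 * L.n) → Bool}
    (hc : L.IsCheckerboard c) (t : Bool) (u' : Fin (L.free + 1) → Bool) :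
    L.deathMap ℚ 0 (L.birth.leeMonomial 0 (L.birth.leeState hc.birth t u')) ∈ L.leeCycles :=
  L.deathMap_mem_leeCycles (leeMonomial_leeState_mem_leeCycles hc.birth t u')

/-! ## Sanity: the unlinks -/

/-- **Sanity (`unknots`), birth.** On the unlink `unknots k` (every enhanced state is canonical,
`leeState_unknots_bijective`; `(unknots k).birth = unknots (k + 1)` definitionally) the unit
sends `𝔰_u` to `-½ • 𝔰_{u, 𝐛} + ½ • 𝔰_{u, 𝐚}`. [cite: Rasmussen2010, Prop. 4.1] -/
theorem birthMap_leeMonomial_leeState_unknots (k : ℕ) (t : Bool) (u : Fin k → Bool) :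
    (unknots k).birthMap ℚ 0 ((unknots k).leeMonomial 0
        ((unknots k).leeState (isCheckerboard_unknots k fun _ ↦ t) t u)) =
      (-(1 / 2) : ℚ) • (unknots (k + 1)).leeMonomial 0 ((unknots (k + 1)).leeState
          (isCheckerboard_unknots (k + 1) fun _ ↦ t) t (Fin.snoc u true)) +
        (1 / 2 : ℚ) • (unknots (k + 1)).leeMonomial 0 ((unknots (k + 1)).leeState
          (isCheckerboard_unknots (k + 1) fun _ ↦ t) t (Fin.snoc u false)) :=
  birthMap_leeMonomial_leeState (L := unknots k) (isCheckerboard_unknots k fun _ ↦ t) t u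

/-- **Sanity (`unknots`), death.** On the unlink the counit sends `𝔰_{u, b}` of
`unknots (k + 1)` to `𝔰_u` of `unknots k`, for both labels `b` of the dying circle.
[cite: Rasmussen2010, Prop. 4.1] -/
theorem deathMap_leeMonomial_leeState_unknots (k : ℕ) (t : Bool) (u : Fin k → Bool)
    (b : Bool) :
    (unknots k).deathMap ℚ 0 ((unknots (k + 1)).leeMonomial 0 ((unknots (k + 1)).leeState
        (isCheckerboard_unknots (k + 1) fun _ ↦ t) t (Fin.snoc u b))) =
      (unknots k).leeMonomial 0 ((unknots k).leeState (isCheckerboard_unknots k fun _ ↦ t) t u) :=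
  deathMap_leeMonomial_leeState_snoc (L := unknots k) (isCheckerboard_unknots k fun _ ↦ t) t u b

end LinkGaussDiagram

end Literature.Topology.FourManifolds

end
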